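import Literature.MathematicalPhysics.QuantumFieldTheory.Balaban1983to89.B3Cor23Concrete
import Literature.MathematicalPhysics.QuantumFieldTheory.Balaban1983to89.B3Eq114AveragingVertices

/-!
# `Balaban1983to89.B3Eq117Legend` — T. Bałaban, *(Higgs)₂,₃ quantum fields in a finite volume. III. Renormalization*,
Commun. Math. Phys. **88** (1983) 411–445 [Balaban1983Higgs3], p. 415 [PDF 5]: the graphical LEGEND **(1.17)** (eleven
symbols) and the three PRODUCT PICTURES **(1.18)**, as a DICTIONARY — symbol by symbol — onto the tree's picture vocabulary
(the concrete graph model `B3Cor23Concrete.Graph` with its legs `B3Cor23Concrete.Leg` and the vertex catalogue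
`B3Prop1.VertexKind`; the analytic expressions (1.12)–(1.15) `B3Eq114AveragingVertices.vertex112…vertex115` and the
p. 414/415 pairing rule `B3Eq114AveragingVertices.pairing_rule`), with the two p. 415 graph sentences as kernel facts of
the model

statement-level skeleton of published theorems with citation tags; proofs where landed; nothing here is a claim about
the Yang–Mills mass gap

PDF held: `paper:balaban1983-higgs-2-3-quantum-fields-finite-volume` (journal page = PDF page + 410); p. 415 read on the ×2
render `run/shared/lean/pub/pub-balaban/b2b-balaban-ref1/pages/1983-cmp88-higgs23-III/1983-cmp88-higgs23-III-p005-x2.png`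
(the legend (1.17) and the pictures (1.18) are drawings; the text layer has only their captions).

CITATION HEADER (lean-in-tree rule).  lit-balaban TYPED SKELETON (HOME `run/shared/lean/pub/lit-balaban/`), row
**B3.Eq1.17-1.18** (owner r15; head `typed p238938`; the owner's B3-CLOSURE §5 item 19 names this free target: *the (1.17)
legend (11 symbols) and the (1.18) product pictures ↦ the tree's picture vocabulary symbol by symbol + the p. 415 graph
notion on the model*).  LOCATED MEMBER, cells only, no head claim.  Unit `lit-balaban-typer` gen 29
(literature-prover-lit-balaban-typer-g29-0).

THE SOURCE TEXT (p. 415, verbatim; the right-hand column of (1.17)/(1.18) are the drawn symbols): *"Now let us introduce a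
graphical description for the perturbative expressions. Let us denote: an external scalar field, or a leg in a vertex [plain
leg]; an external vector field, or a leg in a vertex [wavy leg]; the scalar field propagator G_k(Ω, B̃) [plain line]; the
vector field propagator G_k [wavy line]; the operator (1.13) acting on a scalar field leg; the operator Q_k acting on a vector
field leg; the vertices (1.14) or (1.15); the vertex (1.6); the vertex (1.7); the vertices (1.8) or (1.9); the vertices (1.10)
or (1.11)"* (1.17). *"We introduce also some further notational conventions concerning the expressions obtained by the
expansion of the kernel of the renormalization transformations. They are obtained by taking a scalar product of two
expressions from (1.12)–(1.15) and multiplying it by −a_k, or −½a_k if they are equal. We denote them as follows: a product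
of (1.12) and (1.14) or (1.15); a product of (1.13) and (1.14) or (1.15); a product of two factors of the form (1.14) or
(1.15)."* (1.18) *"The above notations in (1.17) and (1.18) are not precise, but they can be made quite precise if we specify a
number and nature of legs. Now a graph for us is a collection of internal lines, external legs, and vertices connected in the
usual sense. There is at least one internal line, and every internal line has a vertex at each endpoint. The construction of
graphs is otherwise arbitrary."*

WHAT IS TYPED / PROVED (definitions with bodies + small kernel theorems; no `Prop` fact; axioms standard):
* §1 `Symbol117` (the eleven symbols, one constructor per legend line, caption verbatim in the docstring), its sorts
  `isLegSymbol`/`isLineSymbol`/`isOperatorSymbol`/`isVertexSymbol` (a partition: `sorts_exhaustive`);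
* §2 the dictionary onto the catalogue: `Symbol117.ofVertexKind` ((1.13) is drawn as *"the operator (1.13) acting on a scalar
  field leg"*, (1.14)/(1.15) by the one symbol *"the vertices (1.14) or (1.15)"*, …) with its fibres
  (`ofVertexKind_eq_vertex114or115_iff` = `VertexKind.isAveragingVertex`, `ofVertexKind_eq_vertex18or19_iff` = the
  differentiated vertices `diffCount = 1`, `ofVertexKind_eq_op113_iff`, …) and `ofVertexKind_surjective_onto_vertexSymbols`;
* §3 the dictionary onto the model `B3Cor23Concrete.Graph`: `Graph.legSymbol` (φ′-leg ↦ plain, A′-leg ↦ wavy),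
  `Graph.lineSymbol` (internal line ↦ scalar/vector propagator symbol by the sort of its legs; `lineSymbol_symm`: both
  endpoints name the same symbol — the model՚s own «scalar lines join φ′-legs, vector lines join A′-legs»), `Graph.operatorSymbol` (legs of
  the vertices of the form (1.13)–(1.15)), `Graph.vertexSymbol`; the p. 415 graph sentences on the model:
  **`Graph.exists_internal_line`** (*"There is at least one internal line"*), **`Graph.line_endpoints`** (*"every internal line
  has a vertex at each endpoint"*: an internal line is a pair of two distinct legs of vertices of the graph, symmetric);
* §4 (1.18): `Expr1215` (the four expression forms (1.12), (1.13), (1.14)_{n,n′}, (1.15)_{n,n̄}), `Product118` (the three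
  product pictures), `Product118.ofPair` with **`ofPair_isSome_iff`** (*"at least one of them has to be of the form (1.14) or
  (1.15)"*, p. 414) and `ofPair_comm`; the ANALYTIC dictionary `Expr1215.value` (↦ `vertex112…vertex115`), `pairFactor`
  (*"−a_k, or −½a_k if they are equal"*), `productValue`, and **`kernel_exponent_eq_sum_products`**: for any injective finite
  family of expression forms, `−½a|Σ_i value_i|²` = the sum of the (1.18)-type products over the unordered pairs plus the
  squares — `B3Eq114AveragingVertices.pairing_rule` read through the dictionary.
* v1.1 (documentation only; every declaration unchanged): the model's field comment «scalar lines join φ′-legs, vector lines join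
  A′-legs» (tree wording) re-set in «…» instead of the print-italics reserved for verbatim quotations (typer QUOTE-AUDIT delta).
HONEST SCOPE: notation ↦ vocabulary; the drawings themselves are not objects of the tree; nothing on §2's estimates.
-/

open scoped BigOperators InnerProductSpace

namespace Literature.MathematicalPhysics.QuantumFieldTheory.Balaban1983to89.B3Eq117Legend

open Literature.MathematicalPhysics.QuantumFieldTheory.Balaban1983to89.B3Prop1 (VertexKind)
open Literature.MathematicalPhysics.QuantumFieldTheory.Balaban1983to89.B3Cor23Concrete (Leg Graph)
open Literature.MathematicalPhysics.QuantumFieldTheory.Balaban1983to89.HiggsLattice (ChargeData)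
open Literature.MathematicalPhysics.QuantumFieldTheory.Balaban1983to89.HiggsCovariance (E)
open Literature.MathematicalPhysics.QuantumFieldTheory.Balaban1983to89.B3Eq114AveragingVertices
  (vertex112 vertex113 vertex114 vertex115 pairing_rule)

/-! ## §1. The eleven symbols of (1.17) -/

/-- The legend (1.17), p. 415 — one constructor per printed line, in print's order. [cite: Balaban1983Higgs3, (1.17) p.415] -/
inductive Symbol117
  /-- *"an external scalar field, or a leg in a vertex"* (plain leg). -/
  | extScalarLeg
  /-- *"an external vector field, or a leg in a vertex"* (wavy leg). -/
  | extVectorLeg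
  /-- *"the scalar field propagator G_k(Ω, B̃)"* (plain line). -/
  | scalarPropagator
  /-- *"the vector field propagator G_k"* (wavy line). -/
  | vectorPropagator
  /-- *"the operator (1.13) acting on a scalar field leg"*. -/
  | op113OnScalarLeg
  /-- *"the operator Q_k acting on a vector field leg"*. -/
  | opQkOnVectorLeg
  /-- *"the vertices (1.14) or (1.15)"*. -/
  | vertex114or115
  /-- *"the vertex (1.6)"*. -/
  | vertex16
  /-- *"the vertex (1.7)"*. -/
  | vertex17
  /-- *"the vertices (1.8) or (1.9)"*. -/
  | vertex18or19
  /-- *"the vertices (1.10) or (1.11)"*. -/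
  | vertex110or111
  deriving DecidableEq, Fintype

namespace Symbol117

/-- The leg symbols (lines 1–2 of (1.17)). [cite: Balaban1983Higgs3, (1.17) p.415] -/
def isLegSymbol : Symbol117 → Bool
  | extScalarLeg | extVectorLeg => true
  | _ => false

/-- The propagator (internal line) symbols (lines 3–4 of (1.17)). [cite: Balaban1983Higgs3, (1.17) p.415] -/
def isLineSymbol : Symbol117 → Bool
  | scalarPropagator | vectorPropagator => true
  | _ => false

/-- The operator-on-a-leg symbols (lines 5–6 of (1.17)). [cite: Balaban1983Higgs3, (1.17) p.415] -/
def isOperatorSymbol : Symbol117 → Bool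
  | op113OnScalarLeg | opQkOnVectorLeg => true
  | _ => false

/-- The vertex symbols (lines 7–11 of (1.17)). [cite: Balaban1983Higgs3, (1.17) p.415] -/
def isVertexSymbol : Symbol117 → Bool
  | vertex114or115 | vertex16 | vertex17 | vertex18or19 | vertex110or111 => true
  | _ => false

/-- The legend has eleven symbols. [cite: Balaban1983Higgs3, (1.17) p.415] -/
theorem card_eq : Fintype.card Symbol117 = 11 := rfl

/-- The four sorts partition the legend: every symbol is of exactly one sort. [cite: Balaban1983Higgs3, (1.17) p.415] -/
theorem sorts_exhaustive (s : Symbol117) :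
    (s.isLegSymbol = true ∧ s.isLineSymbol = false ∧ s.isOperatorSymbol = false ∧ s.isVertexSymbol = false)
    ∨ (s.isLegSymbol = false ∧ s.isLineSymbol = true ∧ s.isOperatorSymbol = false ∧ s.isVertexSymbol = false)
    ∨ (s.isLegSymbol = false ∧ s.isLineSymbol = false ∧ s.isOperatorSymbol = true ∧ s.isVertexSymbol = false)
    ∨ (s.isLegSymbol = false ∧ s.isLineSymbol = false ∧ s.isOperatorSymbol = false ∧ s.isVertexSymbol = true) := by
  cases s <;> simp [isLegSymbol, isLineSymbol, isOperatorSymbol, isVertexSymbol]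

/-- The scalar/vector nature of a leg, line or operator symbol (`true` = scalar φ′, `false` = vector A′); vertex symbols
carry none. [cite: Balaban1983Higgs3, (1.17) p.415] -/
def isScalar : Symbol117 → Option Bool
  | extScalarLeg | scalarPropagator | op113OnScalarLeg => some true
  | extVectorLeg | vectorPropagator | opQkOnVectorLeg => some false
  | _ => none

/-! ## §2. The dictionary onto the vertex catalogue `B3Prop1.VertexKind` -/

/-- How a catalogue vertex is DRAWN: (1.6), (1.7), (1.8)/(1.9), (1.10)/(1.11), (1.14)/(1.15) by their vertex symbols; (1.13)
(*"In the sequel we will treat (1.13)–(1.15) as the vertices"*, p. 414) by *"the operator (1.13) acting on a scalar field leg"*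
— the legend has no separate vertex symbol for (1.13). [cite: Balaban1983Higgs3, (1.17) p.415] -/
def ofVertexKind : VertexKind → Symbol117
  | .v16 => vertex16
  | .v17 => vertex17
  | .v18 _ _ => vertex18or19
  | .v19 _ _ => vertex18or19
  | .v110 _ _ => vertex110or111
  | .v111 _ _ => vertex110or111
  | .v113 => op113OnScalarLeg
  | .v114 _ _ => vertex114or115
  | .v115 _ _ => vertex114or115

/-- The fibre of *"the vertices (1.14) or (1.15)"* is the token's `isAveragingVertex`. [cite: Balaban1983Higgs3, (1.17) p.415] -/
theorem ofVertexKind_eq_vertex114or115_iff (v : VertexKind) :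
    ofVertexKind v = vertex114or115 ↔ v.isAveragingVertex = true := by
  cases v <;> simp [ofVertexKind, VertexKind.isAveragingVertex]

/-- The fibre of *"the vertices (1.8) or (1.9)"* is the differentiated vertices (`diffCount = 1`).
[cite: Balaban1983Higgs3, (1.17) p.415] -/
theorem ofVertexKind_eq_vertex18or19_iff (v : VertexKind) : ofVertexKind v = vertex18or19 ↔ v.diffCount = 1 := by
  cases v <;> simp [ofVertexKind, VertexKind.diffCount]

/-- The fibre of *"the vertices (1.10) or (1.11)"*. [cite: Balaban1983Higgs3, (1.17) p.415] -/
theorem ofVertexKind_eq_vertex110or111_iff (v : VertexKind) :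
    ofVertexKind v = vertex110or111 ↔ (∃ n n', v = .v110 n n') ∨ ∃ n nb, v = .v111 n nb := by
  cases v <;> simp [ofVertexKind]

/-- The fibre of the operator symbol (1.13) is the vertex (1.13) alone. [cite: Balaban1983Higgs3, (1.17) p.415] -/
theorem ofVertexKind_eq_op113_iff (v : VertexKind) : ofVertexKind v = op113OnScalarLeg ↔ v = .v113 := by
  cases v <;> simp [ofVertexKind]

/-- The fibre of *"the vertex (1.6)"* (`VertexKind.ds = 1`, the only `λ`-vertex) and of *"the vertex (1.7)"*.
[cite: Balaban1983Higgs3, (1.17) p.415] -/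
theorem ofVertexKind_eq_vertex16_17_iff (v : VertexKind) :
    (ofVertexKind v = vertex16 ↔ v = .v16) ∧ (ofVertexKind v = vertex17 ↔ v = .v17) := by
  cases v <;> simp [ofVertexKind]

/-- Every catalogue vertex is drawn by a vertex symbol or, for (1.13), by the operator symbol; no leg/line symbol.
[cite: Balaban1983Higgs3, (1.17) p.415] -/
theorem ofVertexKind_sort (v : VertexKind) :
    (ofVertexKind v).isVertexSymbol = true ∨ (v = .v113 ∧ ofVertexKind v = op113OnScalarLeg) := by
  cases v <;> simp [ofVertexKind, isVertexSymbol]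

/-- Every vertex symbol of the legend draws some catalogue vertex. [cite: Balaban1983Higgs3, (1.17) p.415] -/
theorem ofVertexKind_surjective_onto_vertexSymbols (s : Symbol117) (hs : s.isVertexSymbol = true) :
    ∃ v : VertexKind, ofVertexKind v = s := by
  cases s <;> simp [isVertexSymbol] at hs
  · exact ⟨.v114 1 0, rfl⟩
  · exact ⟨.v16, rfl⟩
  · exact ⟨.v17, rfl⟩
  · exact ⟨.v18 1 0, rfl⟩
  · exact ⟨.v110 2 0, rfl⟩

end Symbol117

/-! ## §3. The dictionary onto the concrete graph model `B3Cor23Concrete.Graph` and the p. 415 graph sentences -/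

namespace Graph

variable {nbar : ℕ} (G : Graph nbar)

/-- A leg of the model is drawn plain (a `φ′`-leg, `inl`) or wavy (an `A′`-leg, `inr`) — lines 1–2 of (1.17), which use
one symbol for *"an external … field, or a leg in a vertex"*. [cite: Balaban1983Higgs3, (1.17) p.415] -/
def legSymbol (x : Leg G.kind) : Symbol117 := if x.2.isLeft then .extScalarLeg else .extVectorLeg

/-- An internal line of the model (a leg `x` with `G.other x = some y`) is drawn as the scalar or the vector propagator
according to the sort of its legs — lines 3–4 of (1.17); an external leg carries no line symbol. [cite: Balaban1983Higgs3, (1.17) p.415] -/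
def lineSymbol (x : Leg G.kind) : Option Symbol117 :=
  match G.other x with
  | none => none
  | some _ => some (if x.2.isLeft then .scalarPropagator else .vectorPropagator)

/-- The legs of the vertices *"of the form (1.13)–(1.15)"* carry the operator symbols — lines 5–6 of (1.17): the `φ′`-leg
*"the operator (1.13) acting on a scalar field leg"*, the `A′`-legs (of (1.14)/(1.15); (1.13) has none) *"the operator Q_k
acting on a vector field leg"* (p. 426: *"If a leg A′ of the line is in one of the vertices (1.14) and (1.15), then we have
the expression A′(Γ…)"*). [cite: Balaban1983Higgs3, (1.17) p.415] -/
def operatorSymbol (x : Leg G.kind) : Option Symbol117 :=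
  if (G.kind x.1).isOfForm1315 then some (if x.2.isLeft then .op113OnScalarLeg else .opQkOnVectorLeg) else none

/-- A vertex of the model is drawn by the symbol of its catalogue kind. [cite: Balaban1983Higgs3, (1.17) p.415] -/
def vertexSymbol (i : Fin G.nV) : Symbol117 := Symbol117.ofVertexKind (G.kind i)

/-- Leg symbols are leg symbols, of the leg's sort. [cite: Balaban1983Higgs3, (1.17) p.415] -/
theorem legSymbol_sort (x : Leg G.kind) :
    (legSymbol G x).isLegSymbol = true ∧ (legSymbol G x).isScalar = some x.2.isLeft := by
  unfold legSymbol
  cases h : x.2.isLeft <;> simp [Symbol117.isLegSymbol, Symbol117.isScalar]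

/-- An internal line is drawn by a line symbol of the sort of its legs; external legs by none.
[cite: Balaban1983Higgs3, (1.17) p.415] -/
theorem lineSymbol_eq (x : Leg G.kind) :
    lineSymbol G x = if (G.other x).isSome then
      some (if x.2.isLeft then Symbol117.scalarPropagator else Symbol117.vectorPropagator) else none := by
  unfold lineSymbol
  cases h : G.other x <;> simp

/-- **Both endpoints of an internal line name the same propagator symbol** (the model's own «scalar lines join φ′-legs, vector
lines join A′-legs» — the tree's wording of `Graph.other_isLeft`, not print — and the symmetry `Graph.other_symm`). [cite: Balaban1983Higgs3, (1.17) p.415] -/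
theorem lineSymbol_symm (x y : Leg G.kind) (h : G.other x = some y) : lineSymbol G x = lineSymbol G y := by
  rw [lineSymbol_eq, lineSymbol_eq, h, G.other_symm x y h, G.other_isLeft x y h, Option.isSome_some, Option.isSome_some]

/-- Operator symbols sit exactly on the legs of the vertices of the form (1.13)–(1.15), with the leg's sort.
[cite: Balaban1983Higgs3, (1.17) p.415] -/
theorem operatorSymbol_isSome_iff (x : Leg G.kind) :
    (operatorSymbol G x).isSome = true ↔ (G.kind x.1).isOfForm1315 = true := by
  unfold operatorSymbol
  split_ifs with h <;> simp [h]

/-- **p. 415: *"There is at least one internal line"*** — in the model (`Graph.exists_line`) some leg carries a propagator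
symbol. [cite: Balaban1983Higgs3, p.415] -/
theorem exists_internal_line : ∃ x : Leg G.kind, (lineSymbol G x).isSome = true := by
  obtain ⟨x, hx⟩ := G.exists_line
  refine ⟨x, ?_⟩
  rw [lineSymbol_eq, if_pos hx]
  rfl

/-- **p. 415: *"every internal line has a vertex at each endpoint"*** — in the model an internal line through the leg `x` is
the pair `{x, y}` of two DISTINCT legs, `x` a leg of the vertex `x.1` and `y` a leg of the vertex `y.1` of `G`, the relation
being symmetric and sort-preserving; both endpoints are drawn by the same propagator symbol. [cite: Balaban1983Higgs3, p.415] -/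
theorem line_endpoints (x y : Leg G.kind) (h : G.other x = some y) :
    y ≠ x ∧ G.other y = some x ∧ x.2.isLeft = y.2.isLeft
      ∧ (∃ i j : Fin G.nV, x.1 = i ∧ y.1 = j) ∧ lineSymbol G x = lineSymbol G y :=
  ⟨G.other_ne x y h, G.other_symm x y h, G.other_isLeft x y h, ⟨x.1, y.1, rfl, rfl⟩, lineSymbol_symm G x y h⟩

/-- The vertex symbol of a vertex of the form (1.14)/(1.15) is *"the vertices (1.14) or (1.15)"*, and conversely.
[cite: Balaban1983Higgs3, (1.17) p.415] -/
theorem vertexSymbol_eq_vertex114or115_iff (i : Fin G.nV) :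
    vertexSymbol G i = Symbol117.vertex114or115 ↔ (G.kind i).isAveragingVertex = true :=
  Symbol117.ofVertexKind_eq_vertex114or115_iff _

end Graph

/-! ## §4. The product pictures (1.18) and their analytic dictionary -/

/-- The four forms of *"expressions from (1.12)–(1.15)"* entering the products (1.18). [cite: Balaban1983Higgs3, (1.18) p.415] -/
inductive Expr1215
  /-- (1.12): the external field `φ(y)`. -/
  | e112
  /-- (1.13): `−(Q_k(B̃)φ′)(y)`. -/
  | e113
  /-- (1.14) with `n` legs of `A′` and `n′` legs of `Ã`. -/
  | e114 (n n' : ℕ)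
  /-- (1.15), the R-vertex, `n` legs of `A′`, `n̄ + 1` of `Ã`. -/
  | e115 (n nbar : ℕ)
  deriving DecidableEq

namespace Expr1215

/-- *"of the form (1.14) or (1.15)"*. [cite: Balaban1983Higgs3, (1.18) p.415] -/
def isAvg : Expr1215 → Bool
  | e114 _ _ | e115 _ _ => true
  | _ => false

/-- The expression forms (1.13)–(1.15) are the catalogue's vertices of the form (1.13)–(1.15). [cite: Balaban1983Higgs3, p.414] -/
def toVertexKind : Expr1215 → Option VertexKind
  | e112 => none
  | e113 => some .v113
  | e114 n n' => some (.v114 n n')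
  | e115 n nb => some (.v115 n nb)

/-- `isAvg` agrees with the token's `isAveragingVertex`. [cite: Balaban1983Higgs3, (1.18) p.415] -/
theorem isAvg_iff (e : Expr1215) : e.isAvg = true ↔ ∃ v, e.toVertexKind = some v ∧ v.isAveragingVertex = true := by
  cases e <;> simp [isAvg, toVertexKind, VertexKind.isAveragingVertex]

end Expr1215

/-- The three product pictures (1.18). [cite: Balaban1983Higgs3, (1.18) p.415] -/
inductive Product118
  /-- *"a product of (1.12) and (1.14) or (1.15)"*. -/
  | p112x1415
  /-- *"a product of (1.13) and (1.14) or (1.15)"*. -/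
  | p113x1415
  /-- *"a product of two factors of the form (1.14) or (1.15)"*. -/
  | p1415x1415
  deriving DecidableEq, Fintype

namespace Product118

/-- Which picture of (1.18) a pair of expression forms is; `none` for the pairs inside {(1.12), (1.13)} (p. 414: *"with the
restriction that at least one of them has to be of the form (1.14) or (1.15)"*). [cite: Balaban1983Higgs3, (1.18) p.415] -/
def ofPair : Expr1215 → Expr1215 → Option Product118
  | .e112, e => if e.isAvg then some p112x1415 else none
  | .e113, e => if e.isAvg then some p113x1415 else none
  | .e114 _ _, .e112 => some p112x1415
  | .e115 _ _, .e112 => some p112x1415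
  | .e114 _ _, .e113 => some p113x1415
  | .e115 _ _, .e113 => some p113x1415
  | .e114 _ _, .e114 _ _ => some p1415x1415
  | .e114 _ _, .e115 _ _ => some p1415x1415
  | .e115 _ _, .e114 _ _ => some p1415x1415
  | .e115 _ _, .e115 _ _ => some p1415x1415

/-- **p. 414/415: a pair of expressions is one of the pictures (1.18) iff *"at least one of them [is] of the form (1.14) or
(1.15)"*.** [cite: Balaban1983Higgs3, (1.18) p.415] -/
theorem ofPair_isSome_iff (e e' : Expr1215) : (ofPair e e').isSome = true ↔ e.isAvg = true ∨ e'.isAvg = true := by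
  cases e <;> cases e' <;> simp [ofPair, Expr1215.isAvg]

/-- The pictures do not depend on the order of the two factors. [cite: Balaban1983Higgs3, (1.18) p.415] -/
theorem ofPair_comm (e e' : Expr1215) : ofPair e e' = ofPair e' e := by
  cases e <;> cases e' <;> simp [ofPair, Expr1215.isAvg]

/-- The three pictures are exactly the three sorts of admissible pairs. [cite: Balaban1983Higgs3, (1.18) p.415] -/
theorem ofPair_eq (e e' : Expr1215) :
    ofPair e e' = if e.isAvg || e'.isAvg then
      some (if e = .e112 ∨ e' = .e112 then p112x1415 else if e = .e113 ∨ e' = .e113 then p113x1415 else p1415x1415)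
      else none := by
  cases e <;> cases e' <;> simp [ofPair, Expr1215.isAvg]

end Product118

section Analytic

variable {P : HiggsLattice.Params} {N : ℕ} (C : ChargeData N) (w : ℝ) (β α τ : HiggsLattice.Site P 0 → ℝ)
  (φ' : HiggsLattice.ScalarField P 0 N) (k : ℕ) (φ : HiggsLattice.ScalarField P k N) (nbar : ℕ) (y : HiggsLattice.Site P k)

/-- The ANALYTIC dictionary: an expression form ↦ its expression (1.12)–(1.15) of `B3Eq114AveragingVertices` (at the block
point `y`, remainder order `n̄` for (1.15)). [cite: Balaban1983Higgs3, (1.12)–(1.15) pp.413–414] -/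
noncomputable def Expr1215.value : Expr1215 → E N
  | .e112 => vertex112 φ y
  | .e113 => vertex113 C w β φ' k y
  | .e114 n n' => vertex114 C w β α τ φ' k n n' y
  | .e115 n nb => vertex115 C w β α τ φ' k nb n y

/-- *"multiplying it by −a_k, or −½a_k if they are equal"*. [cite: Balaban1983Higgs3, (1.18) p.415] -/
noncomputable def pairFactor (a : ℝ) (e e' : Expr1215) : ℝ := if e = e' then -(1 / 2 : ℝ) * a else -a

/-- The value of a product (1.18) (or of a pair inside {(1.12),(1.13)}): the scalar product of the two expressions times the
pair factor. [cite: Balaban1983Higgs3, (1.18) p.415] -/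
noncomputable def productValue (a : ℝ) (e e' : Expr1215) : ℝ :=
  pairFactor a e e' * ⟪Expr1215.value C w β α τ φ' k φ y e, Expr1215.value C w β α τ φ' k φ y e'⟫_ℝ

/-- **The expansion of the kernel of the renormalization transformation IS the sum of the products** (p. 415 *"They are
obtained by taking a scalar product of two expressions from (1.12)–(1.15) and multiplying it by −a_k, or −½a_k if they are
equal"*): for every injective finite family `ε : Fin m → Expr1215` of expression forms,
`−½a|Σ_i value(ε_i)|² = Σ_i productValue(ε_i, ε_i) + Σ_{i<j} productValue(ε_i, ε_j)` — the squares with `−½a`, the pairs of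
different expressions with `−a` (`B3Eq114AveragingVertices.pairing_rule` through the dictionary).
[cite: Balaban1983Higgs3, (1.18) p.415] -/
theorem kernel_exponent_eq_sum_products (a : ℝ) {m : ℕ} (ε : Fin m → Expr1215) (hε : Function.Injective ε) :
    -(1 / 2 : ℝ) * a * ‖∑ i, Expr1215.value C w β α τ φ' k φ y (ε i)‖ ^ 2
      = (∑ i, productValue C w β α τ φ' k φ y a (ε i) (ε i))
        + ∑ i, ∑ j ∈ Finset.univ.filter (fun j => i < j), productValue C w β α τ φ' k φ y a (ε i) (ε j) := by
  rw [pairing_rule Finset.univ (fun i => Expr1215.value C w β α τ φ' k φ y (ε i)) a]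
  unfold productValue pairFactor
  congr 1
  · refine Finset.sum_congr rfl fun i _ => ?_
    rw [if_pos rfl, real_inner_self_eq_norm_sq]
  · refine Finset.sum_congr rfl fun i _ => Finset.sum_congr rfl fun j hj => ?_
    rw [Finset.mem_filter] at hj
    rw [if_neg fun h => by
      have hij := hε h
      subst hij
      exact lt_irrefl _ hj.2]

/-- Which terms of that sum are pictures (1.18): exactly those with at least one factor of the form (1.14)/(1.15); the
others (pairs inside {(1.12),(1.13)}) are the unperturbed kernel (`B3Eq114AveragingVertices.pairing_base`).
[cite: Balaban1983Higgs3, (1.18) p.415] -/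
theorem product_is_picture_iff (e e' : Expr1215) :
    (Product118.ofPair e e').isSome = true ↔ e.isAvg = true ∨ e'.isAvg = true :=
  Product118.ofPair_isSome_iff e e'

end Analytic

end Literature.MathematicalPhysics.QuantumFieldTheory.Balaban1983to89.B3Eq117Legend
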